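import Summits.AnomalousDissipation.AnomalousDissipation.Theorems.MarginalStabilityChainStrainedLayerLawStubVorticityUniformBoundsD
import Summits.AnomalousDissipation.AnomalousDissipation.Theorems.MarginalStabilityChainStrainedLayerLawStubStrainWorkIdentityA
import Summits.AnomalousDissipation.AnomalousDissipation.Theorems.MarginalStabilityChainStrainedLayerLawStubMomentPairKernelStrip

/-!
# Stub `stub_vorticityUniformBounds` (crux stmt-AnomalousDissipation-3007, line `strain-work-sum-rule`) — tools G:
# tails bounds for the vorticity, the size of Kato's right-hand side, and the weighted enstrophy balance

Support file (`--supports stmt-AnomalousDissipation-3007`; registered sub-goals `stub_vorticityUniformBounds_rhsBound`,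
`stub_vorticityUniformBounds_enstrophyStatic`).
* Shear-tails bounds for the vorticity slice: `|ω| ≤ Ce^{−k|y|}`, `|∂_yω| = |Δu| ≤ Ce^{−k|y|}`.
* `stub_vorticityUniformBounds_rhsBound`: for a cutoff with `|ψ′| ≤ D` supported in `|y| ≤ 2R`,
  `∫∫ (|ω| + ε)|v − y||ψ′| + ν∫∫ |∂_yω||ψ′| ≤ D·C·∫∫(C + |y|)e^{−k|y|} + ε·D(C + 2R)e²∫∫e^{−|y|/R} + ν·D·C·∫∫e^{−k|y|}`.
* `stub_vorticityUniformBounds_enstrophyStatic`: the weak vorticity balance (tools D) tested against `Φ = ωθ(y)`: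
  `2∫∫ ωθ (∂ₓb − ∂_ya) = ∫∫ ω²θ + ∫∫ ω²(v − y)θ′ − 2ν∫∫ |∇ω|²θ − 2ν∫∫ ω ∂_yω θ′` (formally, with `θ = 1`, the enstrophy law
  `Ω′ = Ω − 2ν‖∇ω‖²` of the stretched layer).
All `[folklore]`.
-/

-- `Summit.<Summit>.<Problem>` is the tree's mandated summit-side namespace (CONVENTIONS §2); for this
-- single-conjunct summit the two coincide, so the duplicate is deliberate.
set_option linter.dupNamespace false

noncomputable section

open scoped Topology ENNReal
open Filter Set Function MeasureTheory

namespace Summit.AnomalousDissipation.AnomalousDissipation.Theorems.StrainedLayerLaw.StrainWorkSumRule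

open Literature.Analysis.FluidPDE Literature.Analysis.FluidPDE.StretchedLayer
open Summit.AnomalousDissipation.AnomalousDissipation.Theorems.MarginalStabilityChainStretchedVortexRows

/-! ## Shear-tails bounds for the vorticity slice -/

section TailsBounds

/-- `|∂_yω| = |Δu| ≤ Ce^{−k|y|}` for a `C²` divergence-free slice with shear tails. [folklore] -/
theorem kato_abs_dY_vorticity_le {C k : ℝ} {f g : ℝ → ℝ → ℝ} (h : SliceTails C k f g)
    (hf : ContDiff ℝ 2 (fun q : ℝ × ℝ => f q.1 q.2)) (hg : ContDiff ℝ 2 (fun q : ℝ × ℝ => g q.1 q.2))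
    (hdiv : ∀ x y, dX f x y + dY g x y = 0) (x y : ℝ) :
    |dY (vorticity f g) x y| ≤ C * Real.exp (-k * |y|) := by
  rw [show dY (vorticity f g) x y = -lap f x y by rw [lap_eq_neg_dY_vorticity hf hg hdiv x y, neg_neg], abs_neg]
  exact h.abs_lap_u_le x y

end TailsBounds

/-! ## Bounding the right-hand side by the shear tails -/

section RhsBound

/-- The layer weights `e^{−k|y|}` and `(C + |y|)e^{−k|y|}` and are integrable on the period strip. [folklore] -/
theorem kato_integrableOn_weight {k : ℝ} (hk : 0 < k) (L : ℝ) :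
    IntegrableOn (fun q : ℝ × ℝ => Real.exp (-k * |q.2|)) (Ioc 0 L ×ˢ univ) :=
  integrableOn_strip_of_abs_le_exp (C := 1) (by fun_prop) zero_le_one hk fun x _ y => by
    rw [abs_of_nonneg (Real.exp_pos _).le, one_mul]

/-- see `kato_integrableOn_weight`. [folklore] -/
theorem kato_integrableOn_weight' {k C : ℝ} (hk : 0 < k) (hC : 0 ≤ C) (L : ℝ) :
    IntegrableOn (fun q : ℝ × ℝ => (C + |q.2|) * Real.exp (-k * |q.2|)) (Ioc 0 L ×ˢ univ) := by
  refine integrableOn_strip_of_abs_le_sq_exp (C := max C 1) (by fun_prop) hk fun x _ y => ?_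
  rw [abs_of_nonneg (by positivity)]
  have h1 : C + |y| ≤ max C 1 * (1 + |y|) ^ 2 := by
    nlinarith [le_max_left C 1, le_max_right C 1, abs_nonneg y, sq_nonneg (|y|)]
  calc (C + |y|) * Real.exp (-k * |y|) ≤ max C 1 * (1 + |y|) ^ 2 * Real.exp (-k * |y|) :=
        mul_le_mul_of_nonneg_right h1 (Real.exp_pos _).le
    _ = max C 1 * ((1 + |y|) ^ 2 * Real.exp (-k * |y|)) := by ring

/-- **The right-hand side of Kato's inequality is small in the shear-tails class.** For a `C²` divergence-free
slice with `SliceTails C k`, a cutoff whose derivative is bounded by `D` and supported in `|y| ≤ 2R`, `ε, ν ≥ 0`: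
`∫∫ (|ω| + ε)|v − y||ψ′| + ν∫∫ |∂_yω||ψ′| ≤ D·C·∫∫(C + |y|)e^{−k|y|} + ε·D(C + 2R)e²∫∫e^{−|y|/R} + ν·D·C∫∫e^{−k|y|}`.
[folklore] -/
theorem stub_vorticityUniformBounds_rhsBound {L C k : ℝ} (hk : 0 < k) {f g : ℝ → ℝ → ℝ} (hT : SliceTails C k f g)
    (hf : ContDiff ℝ 2 (fun q : ℝ × ℝ => f q.1 q.2)) (hg : ContDiff ℝ 2 (fun q : ℝ × ℝ => g q.1 q.2))
    (hdiv : ∀ x y, dX f x y + dY g x y = 0) {ψ : ℝ → ℝ} (hψ : ContDiff ℝ 1 ψ) {R D : ℝ} (hR : 0 < R)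
    (hD : 0 ≤ D) (hψ'b : ∀ y, |deriv ψ y| ≤ D) (hψ'0 : ∀ y, 2 * R < |y| → deriv ψ y = 0) {ε ν : ℝ}
    (hε : 0 ≤ ε) (hν : 0 ≤ ν) :
    (∫ q in Ioc 0 L ×ˢ univ, (|vorticity f g q.1 q.2| + ε) * |g q.1 q.2 - q.2| * |deriv ψ q.2|) +
        ν * ∫ q in Ioc 0 L ×ˢ univ, |dY (vorticity f g) q.1 q.2| * |deriv ψ q.2| ≤
      (D * C * ∫ q in Ioc 0 L ×ˢ univ, (C + |q.2|) * Real.exp (-k * |q.2|)) +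
        ε * (D * (C + 2 * R) * Real.exp 2 * ∫ q in Ioc 0 L ×ˢ univ, Real.exp (-(1 / R) * |q.2|)) +
        ν * (D * C * ∫ q in Ioc 0 L ×ˢ univ, Real.exp (-k * |q.2|)) := by
  have hC : 0 ≤ C := hT.nonneg
  have hω1 : ContDiff ℝ 1 (fun q : ℝ × ℝ => vorticity f g q.1 q.2) := contDiff_one_vorticity hf hg
  have cω : Continuous fun q : ℝ × ℝ => vorticity f g q.1 q.2 := hω1.continuous
  have cωy : Continuous fun q : ℝ × ℝ => dY (vorticity f g) q.1 q.2 := continuous_dY hω1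
  have cg : Continuous fun q : ℝ × ℝ => g q.1 q.2 := hg.continuous
  have cψ' : Continuous (deriv ψ) := hψ.continuous_deriv le_rfl
  have hψ'0' : ∀ y, 2 * R + 1 ≤ |y| → deriv ψ y = 0 := fun y hy => hψ'0 y (by linarith)
  -- integrability
  have iW := kato_integrableOn_weight' hk hC L
  have ik := kato_integrableOn_weight hk L
  have iR := kato_integrableOn_weight (one_div_pos.2 hR) L
  have i1 : IntegrableOn (fun q : ℝ × ℝ => (|vorticity f g q.1 q.2| + ε) * |g q.1 q.2 - q.2| * |deriv ψ q.2|)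
      (Ioc 0 L ×ˢ univ) :=
    kato_integrableOn_strip_of_eq_zero (R := 2 * R + 1) (by fun_prop) fun x _ y hy => by
      simp only [hψ'0' y hy, abs_zero, mul_zero]
  have i2 : IntegrableOn (fun q : ℝ × ℝ => |dY (vorticity f g) q.1 q.2| * |deriv ψ q.2|) (Ioc 0 L ×ˢ univ) :=
    kato_integrableOn_strip_of_eq_zero (R := 2 * R + 1) (by fun_prop) fun x _ y hy => by
      simp only [hψ'0' y hy, abs_zero, mul_zero]
  have im1 : IntegrableOn (fun q : ℝ × ℝ => D * C * ((C + |q.2|) * Real.exp (-k * |q.2|)) +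
      ε * (D * (C + 2 * R) * Real.exp 2) * Real.exp (-(1 / R) * |q.2|)) (Ioc 0 L ×ˢ univ) :=
    (iW.const_mul (D * C)).add (iR.const_mul (ε * (D * (C + 2 * R) * Real.exp 2)))
  have im2 : IntegrableOn (fun q : ℝ × ℝ => D * C * Real.exp (-k * |q.2|)) (Ioc 0 L ×ˢ univ) :=
    ik.const_mul (D * C)
  -- the first integral
  have e1 : ∫ q in Ioc 0 L ×ˢ univ, (|vorticity f g q.1 q.2| + ε) * |g q.1 q.2 - q.2| * |deriv ψ q.2| ≤
      (D * C * ∫ q in Ioc 0 L ×ˢ univ, (C + |q.2|) * Real.exp (-k * |q.2|)) +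
        ε * (D * (C + 2 * R) * Real.exp 2 * ∫ q in Ioc 0 L ×ˢ univ, Real.exp (-(1 / R) * |q.2|)) := by
    have e := integral_mono i1 im1 fun q => ?_
    · refine e.trans_eq ?_
      rw [integral_add (iW.const_mul (D * C)) (iR.const_mul _), integral_const_mul, integral_const_mul]
      ring
    rcases q with ⟨x, y⟩
    simp only
    by_cases hy : 2 * R < |y|
    · rw [hψ'0 y hy, abs_zero, mul_zero]; positivity
    · push Not at hy
      have hω := tails_abs_vorticity_le hT x y
      have hgy : |g x y - y| ≤ C + |y| := by
        have h1 := hT.abs_v_le_const hk x y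
        calc |g x y - y| ≤ |g x y| + |y| := abs_sub _ _
          _ ≤ C + |y| := by linarith
      have hψy := hψ'b y
      have hw : 1 ≤ Real.exp 2 * Real.exp (-(1 / R) * |y|) := by
        rw [← Real.exp_add]
        refine Real.one_le_exp ?_
        have : (1 / R) * |y| ≤ 2 := by
          rw [one_div, inv_mul_le_iff₀ hR]; linarith
        linarith
      have step1 : (|vorticity f g x y| + ε) * |g x y - y| * |deriv ψ y| ≤
          (C * Real.exp (-k * |y|) + ε) * (C + |y|) * D :=
        mul_le_mul (mul_le_mul (by linarith) hgy (abs_nonneg _) (by positivity)) hψy (abs_nonneg _)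
          (by positivity)
      have step2 : ε * (C + |y|) * D ≤ ε * (D * (C + 2 * R) * Real.exp 2) * Real.exp (-(1 / R) * |y|) := by
        have h1 : C + |y| ≤ (C + 2 * R) * (Real.exp 2 * Real.exp (-(1 / R) * |y|)) := by
          calc C + |y| ≤ (C + 2 * R) * 1 := by linarith
            _ ≤ (C + 2 * R) * (Real.exp 2 * Real.exp (-(1 / R) * |y|)) :=
                mul_le_mul_of_nonneg_left hw (by positivity)
        calc ε * (C + |y|) * D = (ε * D) * (C + |y|) := by ring
          _ ≤ (ε * D) * ((C + 2 * R) * (Real.exp 2 * Real.exp (-(1 / R) * |y|))) :=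
              mul_le_mul_of_nonneg_left h1 (by positivity)
          _ = ε * (D * (C + 2 * R) * Real.exp 2) * Real.exp (-(1 / R) * |y|) := by ring
      calc (|vorticity f g x y| + ε) * |g x y - y| * |deriv ψ y|
          ≤ (C * Real.exp (-k * |y|) + ε) * (C + |y|) * D := step1
        _ = D * C * ((C + |y|) * Real.exp (-k * |y|)) + ε * (C + |y|) * D := by ring
        _ ≤ D * C * ((C + |y|) * Real.exp (-k * |y|)) +
            ε * (D * (C + 2 * R) * Real.exp 2) * Real.exp (-(1 / R) * |y|) := by linarith
  -- the second integral
  have e2 : ∫ q in Ioc 0 L ×ˢ univ, |dY (vorticity f g) q.1 q.2| * |deriv ψ q.2| ≤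
      D * C * ∫ q in Ioc 0 L ×ˢ univ, Real.exp (-k * |q.2|) := by
    rw [← integral_const_mul]
    refine integral_mono i2 im2 fun q => ?_
    rcases q with ⟨x, y⟩
    simp only
    have h1 := kato_abs_dY_vorticity_le hT hf hg hdiv x y
    calc |dY (vorticity f g) x y| * |deriv ψ y| ≤ C * Real.exp (-k * |y|) * D :=
          mul_le_mul h1 (hψ'b y) (abs_nonneg _) (by positivity)
      _ = D * C * Real.exp (-k * |y|) := by ring
  have e3 := mul_le_mul_of_nonneg_left e2 hν
  linarith

end RhsBound


/-! ## The enstrophy balance at one instant, tested against a weight across the layer -/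

section EnstrophyStatic

/-- **The weighted enstrophy balance at one instant (registered sub-goal
`stub_vorticityUniformBounds_enstrophyStatic`).** In the setting of `stub_vorticityUniformBounds_weakVorticity`, test
the weak vorticity balance against `Φ = ω θ(y)` with `θ ∈ C¹(ℝ)` vanishing for `|y| ≥ R`:
`2∫∫ ωθ (∂ₓb − ∂_ya) = ∫∫ ω²θ + ∫∫ ω²(v − y)θ′ − 2ν∫∫ |∇ω|²θ − 2ν∫∫ ω ∂_yω θ′`
(transport `ω(u∂ₓΦ + (v − y)∂_yΦ) = (u, v − y)·∇(ω²/2) θ + ω²(v − y)θ′`, integration by parts and `∂ₓu + ∂_yv = 0`;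
viscosity `∇ω·∇Φ = |∇ω|²θ + ω∂_yω θ′`). With `θ = 1` formally this is the enstrophy law `Ω′ = Ω − 2ν‖∇ω‖²`
of the stretched layer (the stretching feeds the enstrophy at unit rate). [folklore] -/
theorem stub_vorticityUniformBounds_enstrophyStatic : ∀ (L ν R : ℝ) (u v p a b : ℝ → ℝ → ℝ) (θ : ℝ → ℝ),
    0 < L →
    ContDiff ℝ 2 (fun q : ℝ × ℝ => u q.1 q.2) → ContDiff ℝ 2 (fun q : ℝ × ℝ => v q.1 q.2) →
    ContDiff ℝ 1 (fun q : ℝ × ℝ => p q.1 q.2) → ContDiff ℝ 1 (fun q : ℝ × ℝ => a q.1 q.2) →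
    ContDiff ℝ 1 (fun q : ℝ × ℝ => b q.1 q.2) →
    (∀ x y, a x y + u x y * dX u x y + (v x y - y) * dY u x y = -dX p x y + ν * lap u x y) →
    (∀ x y, b x y + u x y * dX v x y + (v x y - y) * dY v x y - v x y = -dY p x y + ν * lap v x y) →
    (∀ x y, dX u x y + dY v x y = 0) →
    (∀ x y, u (x + L) y = u x y) → (∀ x y, v (x + L) y = v x y) → (∀ x y, p (x + L) y = p x y) →
    (∀ x y, b (x + L) y = b x y) →
    ContDiff ℝ 1 θ → (∀ y, R ≤ |y| → θ y = 0) →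
      2 * ∫ q in Ioc 0 L ×ˢ univ, vorticity u v q.1 q.2 * θ q.2 * (dX b q.1 q.2 - dY a q.1 q.2) =
        (∫ q in Ioc 0 L ×ˢ univ, vorticity u v q.1 q.2 ^ 2 * θ q.2) +
          (∫ q in Ioc 0 L ×ˢ univ, vorticity u v q.1 q.2 ^ 2 * (v q.1 q.2 - q.2) * deriv θ q.2) -
          2 * ν * (∫ q in Ioc 0 L ×ˢ univ,
            (dX (vorticity u v) q.1 q.2 ^ 2 + dY (vorticity u v) q.1 q.2 ^ 2) * θ q.2) -
          2 * ν * ∫ q in Ioc 0 L ×ˢ univ, vorticity u v q.1 q.2 * dY (vorticity u v) q.1 q.2 * deriv θ q.2 := by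
  intro L ν R u v p a b θ hL hu hv hp ha hb hmx hmy hdiv huper hvper hpper hbper hθ hθR
  set ω : ℝ → ℝ → ℝ := vorticity u v with hωdef
  set Φ : ℝ → ℝ → ℝ := fun x y => ω x y * θ y with hΦdef
  -- regularity
  have hu1 : ContDiff ℝ 1 (fun q : ℝ × ℝ => u q.1 q.2) := hu.of_le one_le_two
  have hv1 : ContDiff ℝ 1 (fun q : ℝ × ℝ => v q.1 q.2) := hv.of_le one_le_two
  have hω1 : ContDiff ℝ 1 (fun q : ℝ × ℝ => ω q.1 q.2) := contDiff_one_vorticity hu hv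
  have hΦ1 : ContDiff ℝ 1 (fun q : ℝ × ℝ => Φ q.1 q.2) := hω1.mul (hθ.comp contDiff_snd)
  have cθ : Continuous θ := hθ.continuous
  have cθ' : Continuous (deriv θ) := hθ.continuous_deriv le_rfl
  have cu : Continuous fun q : ℝ × ℝ => u q.1 q.2 := hu.continuous
  have cv : Continuous fun q : ℝ × ℝ => v q.1 q.2 := hv.continuous
  have cux : Continuous fun q : ℝ × ℝ => dX u q.1 q.2 := continuous_dX hu1
  have cvy : Continuous fun q : ℝ × ℝ => dY v q.1 q.2 := continuous_dY hv1
  have cω : Continuous fun q : ℝ × ℝ => ω q.1 q.2 := hω1.continuous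
  have cωx : Continuous fun q : ℝ × ℝ => dX ω q.1 q.2 := continuous_dX hω1
  have cωy : Continuous fun q : ℝ × ℝ => dY ω q.1 q.2 := continuous_dY hω1
  -- periodicity and support of the test function
  have hωper : ∀ x y, ω (x + L) y = ω x y := fun x y => by
    simp only [hωdef, vorticity]; rw [dX_periodic hvper, dY_periodic huper]
  have hΦper : ∀ x y, Φ (x + L) y = Φ x y := fun x y => by simp only [hΦdef, hωper]
  have hΦ0 : ∀ x y, R ≤ |y| → Φ x y = 0 := fun x y hy => by simp only [hΦdef, hθR y hy, mul_zero]
  have hθ'0 : ∀ y, R + 1 ≤ |y| → deriv θ y = 0 := fun y hy =>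
    kato_dY_eq_zero (Φ := fun _ s => θ s) (x := (0:ℝ)) (fun _ s hs => hθR s hs) hy
  -- the slice derivatives of `Φ`
  have hωx : ∀ x y, HasDerivAt (fun s => ω s y) (dX ω x y) x := hasDerivAt_dX_of_contDiff hω1 one_ne_zero
  have hωy : ∀ x y, HasDerivAt (fun s => ω x s) (dY ω x y) y := hasDerivAt_dY_of_contDiff hω1 one_ne_zero
  have hθd : ∀ y, HasDerivAt θ (deriv θ y) y := fun y => (hθ.differentiable one_ne_zero y).hasDerivAt
  have hΦx : ∀ x y, dX Φ x y = dX ω x y * θ y := fun x y => ((hωx x y).mul_const (θ y)).deriv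
  have hΦy : ∀ x y, dY Φ x y = dY ω x y * θ y + ω x y * deriv θ y := fun x y => ((hωy x y).mul (hθd y)).deriv
  -- the weak vorticity balance tested against `Φ`
  have key := stub_vorticityUniformBounds_weakVorticity L ν R u v p a b Φ hL hu hv hp ha hb hΦ1 hmx hmy hdiv
    huper hvper hpper hbper hΦper hΦ0
  rw [show (fun q : ℝ × ℝ => vorticity u v q.1 q.2 * θ q.2 * (dX b q.1 q.2 - dY a q.1 q.2)) =
    fun q : ℝ × ℝ => Φ q.1 q.2 * (dX b q.1 q.2 - dY a q.1 q.2) from rfl, key]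
  -- integrability helpers: a factor `θ` or `θ′`
  have hIθ : ∀ F : ℝ × ℝ → ℝ, Continuous F →
      IntegrableOn (fun q : ℝ × ℝ => F q * θ q.2) (Ioc 0 L ×ˢ univ) := fun F hF =>
    kato_integrableOn_strip_of_eq_zero (R := R) (hF.mul (cθ.comp continuous_snd)) fun x _ y hy => by
      simp only [hθR y hy, mul_zero]
  have hIθ' : ∀ F : ℝ × ℝ → ℝ, Continuous F →
      IntegrableOn (fun q : ℝ × ℝ => F q * deriv θ q.2) (Ioc 0 L ×ˢ univ) := fun F hF =>
    kato_integrableOn_strip_of_eq_zero (R := R + 1) (hF.mul (cθ'.comp continuous_snd)) fun x _ y hy => by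
      simp only [hθ'0 y hy, mul_zero]
  have hS : MeasurableSet (Ioc (0:ℝ) L ×ˢ (univ : Set ℝ)) := measurableSet_Ioc.prod MeasurableSet.univ
  ------------------------------------------------------------------
  -- the transport part: `∫∫ ω(uΦₓ + (v−y)Φ_y) = ½∫∫ω²θ + ½∫∫ω²(v−y)θ′`
  ------------------------------------------------------------------
  have hT : ∫ q in Ioc 0 L ×ˢ univ, ω q.1 q.2 * (u q.1 q.2 * dX Φ q.1 q.2 + (v q.1 q.2 - q.2) * dY Φ q.1 q.2) =
      (1 / 2) * (∫ q in Ioc 0 L ×ˢ univ, ω q.1 q.2 ^ 2 * θ q.2) +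
        (1 / 2) * ∫ q in Ioc 0 L ×ˢ univ, ω q.1 q.2 ^ 2 * (v q.1 q.2 - q.2) * deriv θ q.2 := by
    -- `∇(ω²/2) = ω∇ω`
    have hGx : ∀ x y, HasDerivAt (fun s => ω s y ^ 2 / 2) (ω x y * dX ω x y) x := fun x y => by
      have h := ((hωx x y).mul (hωx x y)).div_const 2
      have e : (fun s => ω s y ^ 2 / 2) = fun s => ω s y * ω s y / 2 := funext fun s => by rw [sq]
      rw [e]; exact h.congr_deriv (by ring)
    have hGy : ∀ x y, HasDerivAt (fun s => ω x s ^ 2 / 2) (ω x y * dY ω x y) y := fun x y => by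
      have h := ((hωy x y).mul (hωy x y)).div_const 2
      have e : (fun s => ω x s ^ 2 / 2) = fun s => ω x s * ω x s / 2 := funext fun s => by rw [sq]
      rw [e]; exact h.congr_deriv (by ring)
    -- integration by parts in `x`
    have ibx : ∫ q in Ioc 0 L ×ˢ univ, (u q.1 q.2 * θ q.2) * (ω q.1 q.2 * dX ω q.1 q.2) =
        -∫ q in Ioc 0 L ×ˢ univ, (dX u q.1 q.2 * θ q.2) * (ω q.1 q.2 ^ 2 / 2) := by
      refine integral_strip_mul_dX_eq_neg hL.le (f := fun x y => u x y * θ y) (g := fun x y => ω x y ^ 2 / 2)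
        (f' := fun x y => dX u x y * θ y) (g' := fun x y => ω x y * dX ω x y)
        (fun x y => (hasDerivAt_dX_of_contDiff hu two_ne_zero x y).mul_const (θ y)) hGx
        (fun y => by fun_prop) (fun y => by fun_prop) (fun y => ?_) ?_ ?_
      · have h1 := huper 0 y; have h2 := hωper 0 y
        rw [zero_add] at h1 h2
        rw [h1, h2]
      · have := hIθ (fun q => u q.1 q.2 * (ω q.1 q.2 * dX ω q.1 q.2)) (by fun_prop)
        exact this.congr_fun (fun q _ => by simp only; ring) hS
      · have := hIθ (fun q => dX u q.1 q.2 * (ω q.1 q.2 ^ 2 / 2)) (by fun_prop)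
        exact this.congr_fun (fun q _ => by simp only; ring) hS
    -- integration by parts in `y`
    have iby : ∫ q in Ioc 0 L ×ˢ univ, ((v q.1 q.2 - q.2) * θ q.2) * (ω q.1 q.2 * dY ω q.1 q.2) =
        -∫ q in Ioc 0 L ×ˢ univ, ((dY v q.1 q.2 - 1) * θ q.2 + (v q.1 q.2 - q.2) * deriv θ q.2) * (ω q.1 q.2 ^ 2 / 2) := by
      refine integral_strip_mul_dY_eq_neg (f := fun x y => (v x y - y) * θ y) (g := fun x y => ω x y ^ 2 / 2)
        (f' := fun x y => (dY v x y - 1) * θ y + (v x y - y) * deriv θ y) (g' := fun x y => ω x y * dY ω x y)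
        (fun x y => ((hasDerivAt_dY_of_contDiff hv two_ne_zero x y).sub (hasDerivAt_id y)).mul (hθd y))
        hGy ?_ ?_ ?_
      · have := hIθ (fun q => (v q.1 q.2 - q.2) * (ω q.1 q.2 * dY ω q.1 q.2)) (by fun_prop)
        exact this.congr_fun (fun q _ => by simp only; ring) hS
      · have h1 := hIθ (fun q => (dY v q.1 q.2 - 1) * (ω q.1 q.2 ^ 2 / 2)) (by fun_prop)
        have h2 := hIθ' (fun q => (v q.1 q.2 - q.2) * (ω q.1 q.2 ^ 2 / 2)) (by fun_prop)
        have h12 : IntegrableOn (fun q : ℝ × ℝ => (dY v q.1 q.2 - 1) * (ω q.1 q.2 ^ 2 / 2) * θ q.2 +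
            (v q.1 q.2 - q.2) * (ω q.1 q.2 ^ 2 / 2) * deriv θ q.2) (Ioc 0 L ×ˢ univ) := h1.add h2
        exact h12.congr_fun (fun q _ => by simp only; ring) hS
      · have := hIθ (fun q => (v q.1 q.2 - q.2) * (ω q.1 q.2 ^ 2 / 2)) (by fun_prop)
        exact this.congr_fun (fun q _ => by simp only; ring) hS
    -- integrability of the pieces
    have iA : IntegrableOn (fun q : ℝ × ℝ => (u q.1 q.2 * θ q.2) * (ω q.1 q.2 * dX ω q.1 q.2)) (Ioc 0 L ×ˢ univ) := by
      have := hIθ (fun q => u q.1 q.2 * (ω q.1 q.2 * dX ω q.1 q.2)) (by fun_prop)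
      exact this.congr_fun (fun q _ => by simp only; ring) hS
    have iB : IntegrableOn (fun q : ℝ × ℝ => ((v q.1 q.2 - q.2) * θ q.2) * (ω q.1 q.2 * dY ω q.1 q.2))
        (Ioc 0 L ×ˢ univ) := by
      have := hIθ (fun q => (v q.1 q.2 - q.2) * (ω q.1 q.2 * dY ω q.1 q.2)) (by fun_prop)
      exact this.congr_fun (fun q _ => by simp only; ring) hS
    have iC : IntegrableOn (fun q : ℝ × ℝ => ω q.1 q.2 ^ 2 * (v q.1 q.2 - q.2) * deriv θ q.2) (Ioc 0 L ×ˢ univ) :=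
      hIθ' (fun q => ω q.1 q.2 ^ 2 * (v q.1 q.2 - q.2)) (by fun_prop)
    have iD : IntegrableOn (fun q : ℝ × ℝ => (dX u q.1 q.2 * θ q.2) * (ω q.1 q.2 ^ 2 / 2)) (Ioc 0 L ×ˢ univ) := by
      have := hIθ (fun q => dX u q.1 q.2 * (ω q.1 q.2 ^ 2 / 2)) (by fun_prop)
      exact this.congr_fun (fun q _ => by simp only; ring) hS
    have iE : IntegrableOn (fun q : ℝ × ℝ => ((dY v q.1 q.2 - 1) * θ q.2 + (v q.1 q.2 - q.2) * deriv θ q.2) *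
        (ω q.1 q.2 ^ 2 / 2)) (Ioc 0 L ×ˢ univ) := by
      have h1 := hIθ (fun q => (dY v q.1 q.2 - 1) * (ω q.1 q.2 ^ 2 / 2)) (by fun_prop)
      have h2 := hIθ' (fun q => (v q.1 q.2 - q.2) * (ω q.1 q.2 ^ 2 / 2)) (by fun_prop)
      have h12 : IntegrableOn (fun q : ℝ × ℝ => (dY v q.1 q.2 - 1) * (ω q.1 q.2 ^ 2 / 2) * θ q.2 +
          (v q.1 q.2 - q.2) * (ω q.1 q.2 ^ 2 / 2) * deriv θ q.2) (Ioc 0 L ×ˢ univ) := h1.add h2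
      exact h12.congr_fun (fun q _ => by simp only; ring) hS
    have iP : IntegrableOn (fun q : ℝ × ℝ => ω q.1 q.2 ^ 2 * θ q.2) (Ioc 0 L ×ˢ univ) :=
      hIθ (fun q => ω q.1 q.2 ^ 2) (by fun_prop)
    -- split the transport integrand
    have e1 : ∫ q in Ioc 0 L ×ˢ univ, ω q.1 q.2 * (u q.1 q.2 * dX Φ q.1 q.2 + (v q.1 q.2 - q.2) * dY Φ q.1 q.2) =
        (∫ q in Ioc 0 L ×ˢ univ, (u q.1 q.2 * θ q.2) * (ω q.1 q.2 * dX ω q.1 q.2)) +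
        (∫ q in Ioc 0 L ×ˢ univ, ((v q.1 q.2 - q.2) * θ q.2) * (ω q.1 q.2 * dY ω q.1 q.2)) +
        ∫ q in Ioc 0 L ×ˢ univ, ω q.1 q.2 ^ 2 * (v q.1 q.2 - q.2) * deriv θ q.2 := by
      have iAB : IntegrableOn (fun q : ℝ × ℝ => (u q.1 q.2 * θ q.2) * (ω q.1 q.2 * dX ω q.1 q.2) +
          ((v q.1 q.2 - q.2) * θ q.2) * (ω q.1 q.2 * dY ω q.1 q.2)) (Ioc 0 L ×ˢ univ) := iA.add iB
      rw [← integral_add iA iB, ← integral_add iAB iC]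
      refine integral_congr_ae (Eventually.of_forall fun q => ?_)
      simp only
      rw [hΦx, hΦy]
      ring
    have e2 : (-∫ q in Ioc 0 L ×ˢ univ, (dX u q.1 q.2 * θ q.2) * (ω q.1 q.2 ^ 2 / 2)) +
        (-∫ q in Ioc 0 L ×ˢ univ, ((dY v q.1 q.2 - 1) * θ q.2 + (v q.1 q.2 - q.2) * deriv θ q.2) * (ω q.1 q.2 ^ 2 / 2)) =
        (1 / 2) * (∫ q in Ioc 0 L ×ˢ univ, ω q.1 q.2 ^ 2 * θ q.2) -
          (1 / 2) * ∫ q in Ioc 0 L ×ˢ univ, ω q.1 q.2 ^ 2 * (v q.1 q.2 - q.2) * deriv θ q.2 := by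
      have iDn : IntegrableOn (fun q : ℝ × ℝ => -((dX u q.1 q.2 * θ q.2) * (ω q.1 q.2 ^ 2 / 2))) (Ioc 0 L ×ˢ univ) :=
        iD.neg
      have iEn : IntegrableOn (fun q : ℝ × ℝ => -(((dY v q.1 q.2 - 1) * θ q.2 + (v q.1 q.2 - q.2) * deriv θ q.2) *
          (ω q.1 q.2 ^ 2 / 2))) (Ioc 0 L ×ˢ univ) := iE.neg
      rw [← integral_neg, ← integral_neg, ← integral_add iDn iEn, ← integral_const_mul, ← integral_const_mul,
        ← integral_sub (iP.const_mul _) (iC.const_mul _)]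
      refine integral_congr_ae (Eventually.of_forall fun q => ?_)
      simp only
      have h1 : dY v q.1 q.2 = -dX u q.1 q.2 := by linarith [hdiv q.1 q.2]
      rw [h1]
      ring
    rw [e1, ibx, iby]
    linarith [e2]
  ------------------------------------------------------------------
  -- the viscous part
  ------------------------------------------------------------------
  have hV : ∫ q in Ioc 0 L ×ˢ univ, (dX ω q.1 q.2 * dX Φ q.1 q.2 + dY ω q.1 q.2 * dY Φ q.1 q.2) =
      (∫ q in Ioc 0 L ×ˢ univ, (dX ω q.1 q.2 ^ 2 + dY ω q.1 q.2 ^ 2) * θ q.2) +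
        ∫ q in Ioc 0 L ×ˢ univ, ω q.1 q.2 * dY ω q.1 q.2 * deriv θ q.2 := by
    rw [← integral_add (hIθ _ (by fun_prop)) (hIθ' _ (by fun_prop))]
    refine integral_congr_ae (Eventually.of_forall fun q => ?_)
    simp only
    rw [hΦx, hΦy]
    ring
  rw [hT, hV]
  ring

end EnstrophyStatic

end Summit.AnomalousDissipation.AnomalousDissipation.Theorems.StrainedLayerLaw.StrainWorkSumRule

end
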